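import Mathlib
import HarnessLib.Audit
import Summits.PneNP.PneNP.Theorems.PstarLiteralPinning

/-!
# The joins of a circuit core: `∅`, the cycle, and the two arcs (ROUND-24, O1; memo g28 §77)

FRONTIER range-avoidance ladder, rung F-N3, ROUND 24 (cell `pnp-ideate`, prover-2 memo `g28/O1-JOINS-g28.md` §77; census node
`PstarLocalGateBudgetAssembly.LocalMenuCriterionBoundGateBudget`; restricted-model proof complexity — nothing here bears on `P` versus `NP`).

Every side condition of the pinning / dead-pattern / member-kill calculus (`PstarLiteralPinning`, `PstarDeadPatterns`, `PstarMemberKillJoins`) has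
the shape «no JOIN `(D, t)` of `K` for `C₁` with property `Q` has value `1`», where `(D, t)` is a join iff the XOR slots of `D ⊆ K` meet every variable
evenly after adding `[t]·[w ∈ C₁]` (`PstarLiteralPinning.IsJoin`).  This file reduces such conditions to FINITELY MANY NAMED CANDIDATES on the cores
the census meets, with no graph theory beyond parity bookkeeping:

* `xpdeg_union` — the XOR degree is additive over disjoint unions; `isJoin_false_iff` — a join without the reader is an even XOR-subgraph;
* **`even_diff_of_joins`** — two joins WITH the reader differ by an even XOR-subgraph: `(D ∖ P) ∪ (P ∖ D)` is even; conversely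
  `isJoin_sdiff` — on an even family `K` the complement `K ∖ P` of a join `P` (with the reader) is again one;
* a CIRCUIT CORE is a family `K` whose only even XOR-subfamilies are `∅` and `K` (hypothesis `hmin`; a cycle core `C₃, C₄, C₅` of the census, and
  also every PATH core, where `K` itself is not even and `∅` is the only even subfamily);
* **`join_false_cases`** / **`join_true_cases`** / **`join_cases`** — on a circuit core the joins are: without the reader `∅` or `K`; with the
  reader `P` or `K ∖ P` for any one join `P` with the reader (the two ARCS); `join_cases_of_none` — if no join uses the reader, only `∅`, `K`;
* **`forall_join_of_four`** / **`forall_join_iff`** — hence «every join satisfies `Q`» follows from (on an even `K`: is equivalent to) the four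
  instances `Q ∅ 0`, `Q K 0`, `Q P 1`, `Q (K ∖ P) 1`; `forall_join_of_two` when no join uses the reader;
* `joinValue_empty`, `joinValue_sdiff` — the values: `v(∅, 0) = 0` and `v(K ∖ P, 1) = v(K, 0) + v(P, 1)`;
* (appended) `isJoin_true_iff_even_diff`, **`forall_join_of_evens`** — GENERAL cores: the joins with the reader are exactly the shifts `P ∆ E` of
  one of them by the even subfamilies `E`, so a list `L ⊇ {even subfamilies}` (theta core: `∅` + three cycles) reduces «every join satisfies `Q`»
  to the instances `(E, 0)`, `(P ∆ E, 1)`, `E ∈ L`.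

USE.  The hypotheses `hidle` / `hpart` of `PstarMemberKillJoins.not_terminal_of_dirty_member_joins` (and the pinning criterion, and every dead
pattern) on a cycle core with chord-path-sum reader become: the cycle has value `0` or a live member / a member off the block, and each of the two
arcs-with-folds has value `0` or a live member or a live fold — p3's «one-block value-1 path» table, for all `k`.  Theta cores (`K₄ − e`): the even
subfamilies are `∅` and the three cycles, and `even_diff_of_joins` lists the joins with the reader as `P ∆ (even)` — four candidates each.
-/

set_option linter.dupNamespace false -- `Summit.PneNP.PneNP.…`: summit = sub-problem name (D-0017 single-conjunct layout)

open Finset Literature.Computability.Complexity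
open Summit.PneNP.PneNP.Theorems.PstarFibrePolys (bit)
open Summit.PneNP.PneNP.Theorems.PstarXorElimination (pdeg)
open Summit.PneNP.PneNP.Theorems.PstarChordBridgeTools (xpdeg)
open Summit.PneNP.PneNP.Theorems.PstarLiteralPinning (IsJoin joinValue)

namespace Summit.PneNP.PneNP.Theorems.PstarCircuitJoins

variable {n m : ℕ} (I : LocalMap 4 n m)

/-! ## Parity bookkeeping -/

/-- **The XOR degree is additive over disjoint unions.** -/
theorem xpdeg_union {A B : Finset (Fin m)} (h : Disjoint A B) (w : Fin n) : xpdeg I (A ∪ B) w = xpdeg I A w + xpdeg I B w := by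
  simp only [xpdeg, pdeg]
  rw [filter_union, filter_union, card_union_of_disjoint (disjoint_filter_filter h), card_union_of_disjoint (disjoint_filter_filter h)]
  ring

/-- The empty family has XOR degree `0` everywhere. -/
theorem xpdeg_empty (w : Fin n) : xpdeg I (∅ : Finset (Fin m)) w = 0 := by
  simp [xpdeg, pdeg]

/-- **A join WITHOUT the reader is an even XOR-subfamily.** -/
theorem isJoin_false_iff (C : Finset (Fin n)) (D : Finset (Fin m)) : IsJoin I C D false ↔ ∀ w, Even (xpdeg I D w) := by
  simp only [IsJoin, Bool.false_eq_true, false_and, if_false, add_zero]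

/-- A join WITH the reader: the XOR degree plus `[w ∈ C]` is even everywhere. -/
theorem isJoin_true_iff (C : Finset (Fin n)) (D : Finset (Fin m)) :
    IsJoin I C D true ↔ ∀ w, Even (xpdeg I D w + if w ∈ C then 1 else 0) := by
  simp only [IsJoin, true_and]

/-- The empty family is a join without the reader. -/
theorem isJoin_empty (C : Finset (Fin n)) : IsJoin I C (∅ : Finset (Fin m)) false :=
  (isJoin_false_iff I C ∅).2 fun w => by rw [xpdeg_empty]; exact Even.zero

/-- **TWO JOINS WITH THE READER DIFFER BY AN EVEN SUBFAMILY**: `(D ∖ P) ∪ (P ∖ D)` is even. -/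
theorem even_diff_of_joins {C : Finset (Fin n)} {P D : Finset (Fin m)} (hPJ : IsJoin I C P true) (hDJ : IsJoin I C D true) (w : Fin n) :
    Even (xpdeg I ((D \ P) ∪ (P \ D)) w) := by
  have h1 := (isJoin_true_iff I C D).1 hDJ w
  have h2 := (isJoin_true_iff I C P).1 hPJ w
  have hDsplit : xpdeg I D w = xpdeg I (D \ P) w + xpdeg I (D ∩ P) w := by
    rw [← xpdeg_union I (disjoint_sdiff_inter D P) w, sdiff_union_inter]
  have hPsplit : xpdeg I P w = xpdeg I (P \ D) w + xpdeg I (D ∩ P) w := by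
    rw [inter_comm, ← xpdeg_union I (disjoint_sdiff_inter P D) w, sdiff_union_inter]
  have hsum := h1.add h2
  rw [hDsplit, hPsplit, show xpdeg I (D \ P) w + xpdeg I (D ∩ P) w + (if w ∈ C then 1 else 0) +
      (xpdeg I (P \ D) w + xpdeg I (D ∩ P) w + if w ∈ C then 1 else 0) =
      (xpdeg I (D \ P) w + xpdeg I (P \ D) w) + 2 * (xpdeg I (D ∩ P) w + if w ∈ C then 1 else 0) by ring] at hsum
  rw [xpdeg_union I disjoint_sdiff_sdiff w]
  exact (Nat.even_add.1 hsum).2 (even_two_mul _)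

/-- Conversely: a join with the reader plus an even subfamily disjoint from it is a join with the reader. -/
theorem isJoin_union_of_even {C : Finset (Fin n)} {P E : Finset (Fin m)} (hPJ : IsJoin I C P true) (hE : ∀ w, Even (xpdeg I E w))
    (hPE : Disjoint P E) : IsJoin I C (P ∪ E) true := by
  rw [isJoin_true_iff] at hPJ ⊢
  intro w
  rw [xpdeg_union I hPE w, show xpdeg I P w + xpdeg I E w + (if w ∈ C then 1 else 0) =
    (xpdeg I P w + if w ∈ C then 1 else 0) + xpdeg I E w by ring]
  exact (hPJ w).add (hE w)

/-- **On an EVEN family the complement of a join with the reader is a join with the reader** (the other arc). -/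
theorem isJoin_sdiff {K : Finset (Fin m)} (hK : ∀ w, Even (xpdeg I K w)) {C : Finset (Fin n)} {P : Finset (Fin m)} (hP : P ⊆ K)
    (hPJ : IsJoin I C P true) : IsJoin I C (K \ P) true := by
  rw [isJoin_true_iff] at hPJ ⊢
  intro w
  have hsplit : xpdeg I K w = xpdeg I (K \ P) w + xpdeg I P w := by
    rw [← xpdeg_union I disjoint_sdiff_self_left w, sdiff_union_of_subset hP]
  have h := (hK w).add (hPJ w)
  rw [hsplit, show xpdeg I (K \ P) w + xpdeg I P w + (xpdeg I P w + if w ∈ C then 1 else 0) =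
    (xpdeg I (K \ P) w + if w ∈ C then 1 else 0) + 2 * xpdeg I P w by ring] at h
  exact (Nat.even_add.1 h).2 (even_two_mul _)

/-! ## Circuit cores: the four joins -/

section Circuit

variable {K : Finset (Fin m)} (hmin : ∀ D ⊆ K, (∀ w, Even (xpdeg I D w)) → D = ∅ ∨ D = K)
include hmin

/-- **Joins WITHOUT the reader on a circuit core: `∅` or `K`.** -/
theorem join_false_cases {C : Finset (Fin n)} {D : Finset (Fin m)} (hD : D ⊆ K) (hJ : IsJoin I C D false) : D = ∅ ∨ D = K :=
  hmin D hD ((isJoin_false_iff I C D).1 hJ)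

/-- **Joins WITH the reader on a circuit core: `P` or `K ∖ P`**, for any one join `P` with the reader (the two arcs). -/
theorem join_true_cases {C : Finset (Fin n)} {P D : Finset (Fin m)} (hP : P ⊆ K) (hPJ : IsJoin I C P true) (hD : D ⊆ K)
    (hDJ : IsJoin I C D true) : D = P ∨ D = K \ P := by
  have hEK : (D \ P) ∪ (P \ D) ⊆ K := union_subset (sdiff_subset.trans hD) (sdiff_subset.trans hP)
  rcases hmin _ hEK (even_diff_of_joins I hPJ hDJ) with h0 | hK
  · left
    rw [union_eq_empty, sdiff_eq_empty_iff_subset, sdiff_eq_empty_iff_subset] at h0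
    exact Subset.antisymm h0.1 h0.2
  · right
    have hDP : Disjoint D P := disjoint_left.2 fun j hjD hjP => by
      have hjK : j ∈ (D \ P) ∪ (P \ D) := hK.symm ▸ hD hjD
      rcases mem_union.1 hjK with h | h
      · exact (mem_sdiff.1 h).2 hjP
      · exact (mem_sdiff.1 h).2 hjD
    ext j
    constructor
    · exact fun hj => mem_sdiff.2 ⟨hD hj, fun hjP => disjoint_left.1 hDP hj hjP⟩
    · intro hj
      obtain ⟨hjK, hjP⟩ := mem_sdiff.1 hj
      rw [← hK, mem_union] at hjK
      rcases hjK with h | h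
      · exact (mem_sdiff.1 h).1
      · exact absurd (mem_sdiff.1 h).1 hjP

/-- **THE FOUR JOINS OF A CIRCUIT CORE.**  Every join `(D, t)` is `(∅, 0)`, `(K, 0)`, `(P, 1)` or `(K ∖ P, 1)`. -/
theorem join_cases {C : Finset (Fin n)} {P : Finset (Fin m)} (hP : P ⊆ K) (hPJ : IsJoin I C P true) {D : Finset (Fin m)} {t : Bool}
    (hD : D ⊆ K) (hJ : IsJoin I C D t) : (t = false ∧ (D = ∅ ∨ D = K)) ∨ (t = true ∧ (D = P ∨ D = K \ P)) := by
  cases t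
  · exact Or.inl ⟨rfl, join_false_cases I hmin hD hJ⟩
  · exact Or.inr ⟨rfl, join_true_cases I hmin hP hPJ hD hJ⟩

/-- **No join uses the reader: only `(∅, 0)` and `(K, 0)`.** -/
theorem join_cases_of_none {C : Finset (Fin n)} (hnone : ∀ P ⊆ K, ¬ IsJoin I C P true) {D : Finset (Fin m)} {t : Bool} (hD : D ⊆ K)
    (hJ : IsJoin I C D t) : t = false ∧ (D = ∅ ∨ D = K) := by
  cases t
  · exact ⟨rfl, join_false_cases I hmin hD hJ⟩
  · exact absurd hJ (hnone D hD)

/-- **EVERY JOIN SATISFIES `Q` ONCE THE FOUR CANDIDATES DO** (no evenness of `K` needed: on a path core `K` and `K ∖ P` are simply not joins and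
their instances are idle). -/
theorem forall_join_of_four {C : Finset (Fin n)} {P : Finset (Fin m)} (hP : P ⊆ K) (hPJ : IsJoin I C P true)
    (Q : Finset (Fin m) → Bool → Prop) (h0 : Q ∅ false) (hK : Q K false) (h1 : Q P true) (h2 : Q (K \ P) true) :
    ∀ D ⊆ K, ∀ t : Bool, IsJoin I C D t → Q D t := by
  intro D hD t hJ
  rcases join_cases I hmin hP hPJ hD hJ with ⟨rfl, rfl | rfl⟩ | ⟨rfl, rfl | rfl⟩ <;> assumption

/-- **… and once the two candidates do, when no join uses the reader.** -/
theorem forall_join_of_two {C : Finset (Fin n)} (hnone : ∀ P ⊆ K, ¬ IsJoin I C P true) (Q : Finset (Fin m) → Bool → Prop)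
    (h0 : Q ∅ false) (hK : Q K false) : ∀ D ⊆ K, ∀ t : Bool, IsJoin I C D t → Q D t := by
  intro D hD t hJ
  rcases join_cases_of_none I hmin hnone hD hJ with ⟨rfl, rfl | rfl⟩ <;> assumption

/-- **On an EVEN circuit core (a cycle core) «every join satisfies `Q`» IS the conjunction of the four instances.** -/
theorem forall_join_iff (hKev : ∀ w, Even (xpdeg I K w)) {C : Finset (Fin n)} {P : Finset (Fin m)} (hP : P ⊆ K) (hPJ : IsJoin I C P true)
    (Q : Finset (Fin m) → Bool → Prop) :
    (∀ D ⊆ K, ∀ t : Bool, IsJoin I C D t → Q D t) ↔ Q ∅ false ∧ Q K false ∧ Q P true ∧ Q (K \ P) true :=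
  ⟨fun h => ⟨h ∅ (empty_subset _) false (isJoin_empty I C), h K Subset.rfl false ((isJoin_false_iff I C K).2 hKev), h P hP true hPJ,
      h (K \ P) sdiff_subset true (isJoin_sdiff I hKev hP hPJ)⟩,
    fun h => forall_join_of_four I hmin hP hPJ Q h.1 h.2.1 h.2.2.1 h.2.2.2⟩

/-- The same when no join uses the reader. -/
theorem forall_join_iff_of_none (hKev : ∀ w, Even (xpdeg I K w)) {C : Finset (Fin n)} (hnone : ∀ P ⊆ K, ¬ IsJoin I C P true)
    (Q : Finset (Fin m) → Bool → Prop) : (∀ D ⊆ K, ∀ t : Bool, IsJoin I C D t → Q D t) ↔ Q ∅ false ∧ Q K false :=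
  ⟨fun h => ⟨h ∅ (empty_subset _) false (isJoin_empty I C), h K Subset.rfl false ((isJoin_false_iff I C K).2 hKev)⟩,
    fun h => forall_join_of_two I hmin hnone Q h.1 h.2⟩

end Circuit

/-! ## Values of the candidates -/

/-- The empty join has value `0`. -/
theorem joinValue_empty (y : Fin m → Bool) (b : Bool) : joinValue y b (∅ : Finset (Fin m)) false = 0 := by
  simp [joinValue]

/-- **The other arc's value**: `v(K ∖ P, 1) = v(K, 0) + v(P, 1)`. -/
theorem joinValue_sdiff (y : Fin m → Bool) (b : Bool) {K P : Finset (Fin m)} (hP : P ⊆ K) :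
    joinValue y b (K \ P) true = joinValue y b K false + joinValue y b P true := by
  simp only [joinValue, if_true, Bool.false_eq_true, if_false, add_zero]
  rw [← sum_sdiff hP]
  have h2 : ∀ x : ZMod 2, x + x = 0 := by decide
  linear_combination (-1 : ZMod 2) * h2 (∑ j ∈ P, bit (y j))

/-- So on a cycle of value `0` the two arcs have EQUAL values, and on a cycle of value `1` exactly one arc has value `1`. -/
theorem joinValue_sdiff_eq_iff (y : Fin m → Bool) (b : Bool) {K P : Finset (Fin m)} (hP : P ⊆ K) :
    joinValue y b (K \ P) true = joinValue y b P true ↔ joinValue y b K false = 0 := by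
  rw [joinValue_sdiff y b hP]
  constructor
  · intro h
    have : joinValue y b K false + joinValue y b P true - joinValue y b P true = 0 := by rw [h]; ring
    simpa using this
  · intro h; rw [h, zero_add]


/-! ## General cores: the joins with the reader are one join shifted by the even subfamilies (appended, memo g28 §77b) -/

/-- **A join with the reader is `P` shifted by an even subfamily**: for a join `P` with the reader and any `D`, `(D, 1)` is a join iff
`(D ∖ P) ∪ (P ∖ D)` is even.  (Theta cores `K₄ − e`: the even subfamilies are `∅` and the three cycles, so the joins with the reader are `P` and its
three shifts.) -/
theorem isJoin_true_iff_even_diff {C : Finset (Fin n)} {P D : Finset (Fin m)} (hPJ : IsJoin I C P true) :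
    IsJoin I C D true ↔ ∀ w, Even (xpdeg I ((D \ P) ∪ (P \ D)) w) := by
  refine ⟨fun hDJ => even_diff_of_joins I hPJ hDJ, fun hE => ?_⟩
  rw [isJoin_true_iff] at hPJ ⊢
  intro w
  have hDsplit : xpdeg I D w = xpdeg I (D \ P) w + xpdeg I (D ∩ P) w := by
    rw [← xpdeg_union I (disjoint_sdiff_inter D P) w, sdiff_union_inter]
  have hPsplit : xpdeg I P w = xpdeg I (P \ D) w + xpdeg I (D ∩ P) w := by
    rw [inter_comm, ← xpdeg_union I (disjoint_sdiff_inter P D) w, sdiff_union_inter]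
  have h2 := hE w
  rw [xpdeg_union I disjoint_sdiff_sdiff w] at h2
  have hsum := (hPJ w).add h2
  rw [hPsplit, show xpdeg I (P \ D) w + xpdeg I (D ∩ P) w + (if w ∈ C then 1 else 0) + (xpdeg I (D \ P) w + xpdeg I (P \ D) w) =
    (xpdeg I (D \ P) w + xpdeg I (D ∩ P) w + if w ∈ C then 1 else 0) + 2 * xpdeg I (P \ D) w by ring, ← hDsplit] at hsum
  exact (Nat.even_add.1 hsum).2 (even_two_mul _)

/-- Shifting twice by the difference returns `D`: `P ∆ (D ∆ P) = D`. -/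
theorem shift_shift_eq (P D : Finset (Fin m)) : (P \ ((D \ P) ∪ (P \ D))) ∪ (((D \ P) ∪ (P \ D)) \ P) = D := by
  ext j
  simp only [mem_union, mem_sdiff]
  tauto

/-- **EVERY JOIN, FROM THE LIST OF EVEN SUBFAMILIES.**  If `L` contains every even subfamily of `K` (a circuit core: `∅, K`; a theta core: `∅` and
its three cycles), then every join of `K` is `(E, 0)` or `(P ∆ E, 1)` with `E ∈ L`, for any one join `P` with the reader; so «every join satisfies
`Q`» follows from the instances over `L`. -/
theorem forall_join_of_evens {K : Finset (Fin m)} (L : Finset (Finset (Fin m))) (hL : ∀ E ⊆ K, (∀ w, Even (xpdeg I E w)) → E ∈ L)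
    {C : Finset (Fin n)} {P : Finset (Fin m)} (hP : P ⊆ K) (hPJ : IsJoin I C P true) (Q : Finset (Fin m) → Bool → Prop)
    (h0 : ∀ E ∈ L, Q E false) (h1 : ∀ E ∈ L, Q ((P \ E) ∪ (E \ P)) true) :
    ∀ D ⊆ K, ∀ t : Bool, IsJoin I C D t → Q D t := by
  intro D hD t hJ
  cases t
  · exact h0 D (hL D hD ((isJoin_false_iff I C D).1 hJ))
  · have hE := hL ((D \ P) ∪ (P \ D)) (union_subset (sdiff_subset.trans hD) (sdiff_subset.trans hP)) (even_diff_of_joins I hPJ hJ)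
    have := h1 _ hE
    rwa [shift_shift_eq] at this

/-- **… and when no join uses the reader**, from the instances `(E, 0)`, `E ∈ L`, alone. -/
theorem forall_join_of_evens_none {K : Finset (Fin m)} (L : Finset (Finset (Fin m))) (hL : ∀ E ⊆ K, (∀ w, Even (xpdeg I E w)) → E ∈ L)
    {C : Finset (Fin n)} (hnone : ∀ P ⊆ K, ¬ IsJoin I C P true) (Q : Finset (Fin m) → Bool → Prop) (h0 : ∀ E ∈ L, Q E false) :
    ∀ D ⊆ K, ∀ t : Bool, IsJoin I C D t → Q D t := by
  intro D hD t hJ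
  cases t
  · exact h0 D (hL D hD ((isJoin_false_iff I C D).1 hJ))
  · exact absurd hJ (hnone D hD)

end Summit.PneNP.PneNP.Theorems.PstarCircuitJoins
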